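import Summits.RiemannHypothesis.RiemannHypothesis.Theorems.WeilWindowFlowWindowLipschitzStubLocalizedCutAux

/-!
# Auxiliary toolkit (part 2) for stub `stub_localizedCut` (line `cut-dont-squeeze`)

Second half of the infrastructure for the localised-cut inequality of the crux
`WeilWindowFlow.WindowLipschitz` (item stmt-RiemannHypothesis-1039):

* the quadratic expansions `q(f − g) = q(f) + q(g) − 2 Re q(f, g)` for `q = ‖·‖₂²`, `D_t`,
  `weilPoleForm`, `weilDirichletEnergy a` on the finite-energy class;
* the window change `𝓔_b(f) − M_b ‖f‖² = 𝓔_a(f) − M_a ‖f‖²` (`b ≤ a`) for `f ∈ L²` vanishing on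
  `|x| ≥ b` (`D_{log n}(f) = 2‖f‖²` for `2b ≤ log n`, cancelling `2 Λ(n) n^{-1/2}` in `M_a − M_b`);
* the pointwise IMS identity `|pU − qV|² − Re((U − V) conj(p²U − q²V)) = (p − q)² Re(U conj V)` and
  its integrated form `D_t(θu) − Re D_t(u, θ²u) ≤ ∫ (χ(x+t) − χ x)² ‖u(x+t)‖ ‖u x‖ dx`, `θ = 1 − χ`;
* convergence of the archimedean commutator `∫₀^∞ ρ(t) ∫ (χ(x+t) − χ x)² ‖u(x+t)‖ ‖u x‖ dx dt`.

Sources: E. Bombieri, *Remarks on Weil's quadratic functional in the theory of prime numbers I*,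
Rend. Mat. Acc. Lincei (9) 11 (2000), §4 Lemma 1 / (4.2); H. Cycon, R. Froese, W. Kirsch,
B. Simon, *Schrödinger Operators*, Springer (1987), Thm 3.2 (IMS localisation formula).
-/

set_option linter.dupNamespace false

noncomputable section

open MeasureTheory Set Filter
open scoped Topology ENNReal NNReal ComplexConjugate ArithmeticFunction.vonMangoldt

namespace Summit.RiemannHypothesis.RiemannHypothesis.Theorems.WeilWindowFlowWindowLipschitz

open Literature.NumberTheory.LFunctions Literature.NumberTheory.LFunctions.ConnesVanSuijlekom

/-! ## Quadratic expansions `q(f − g) = q(f) + q(g) − 2 Re q(f, g)` -/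

/-- `∫‖f − g‖² = ∫‖f‖² + ∫‖g‖² − 2 Re ∫ f ḡ` for `f, g ∈ L²`. -/
theorem stub_localizedCut_integral_norm_sq_sub {f g : ℝ → ℂ} (hf : MemLp f 2) (hg : MemLp g 2) :
    ∫ x, ‖f x - g x‖ ^ 2 =
      (∫ x, ‖f x‖ ^ 2) + (∫ x, ‖g x‖ ^ 2) - 2 * (∫ x, f x * conj (g x)).re := by
  have h := integral_norm_sq_add_mul hf hg (-1)
  have e : (fun x ↦ ‖f x + (-1) * g x‖ ^ 2) = fun x ↦ ‖f x - g x‖ ^ 2 := by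
    funext x
    rw [neg_one_mul, ← sub_eq_add_neg]
  rw [e] at h
  have h1 : Complex.normSq (-1) = 1 := by simp
  have h2 : (starRingEnd ℂ) (-1) = -1 := by simp
  rw [h, h1, h2, neg_one_mul, one_mul, Complex.neg_re]
  ring

/-- `D_t(f − g) = D_t(f) + D_t(g) − 2 Re D_t(f, g)` for `f, g ∈ L²`. -/
theorem stub_localizedCut_weilIncrement_sub {f g : ℝ → ℂ} (hf : MemLp f 2) (hg : MemLp g 2)
    (t : ℝ) :
    weilIncrement (fun x ↦ f x - g x) t = weilIncrement f t + weilIncrement g t -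
      2 * (∫ x, (f (x + t) - f x) * conj (g (x + t) - g x)).re := by
  have hf' : MemLp (fun x ↦ f (x + t) - f x) 2 :=
    (hf.comp_measurePreserving (measurePreserving_add_right volume t)).sub hf
  have hg' : MemLp (fun x ↦ g (x + t) - g x) 2 :=
    (hg.comp_measurePreserving (measurePreserving_add_right volume t)).sub hg
  have h := stub_localizedCut_integral_norm_sq_sub hf' hg'
  unfold weilIncrement
  rw [← h]
  refine integral_congr_ae (ae_of_all _ fun x ↦ ?_)
  simp only
  rw [show f (x + t) - g (x + t) - (f x - g x) = f (x + t) - f x - (g (x + t) - g x) by ring]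

/-- `P(f − g) = P(f) + P(g) − 2 Re P(f, g)` with the sesquilinear pole form
`P(f, g) = 2 (∫ f ch) conj(∫ g ch) − 2 (∫ f sh) conj(∫ g sh)`, `ch = cosh(x/2)`,
`sh = sinh(x/2)`. -/
theorem stub_localizedCut_weilPoleForm_sub {f g : ℝ → ℂ}
    (hfc : Integrable fun x ↦ f x * (Real.cosh (x / 2) : ℂ))
    (hgc : Integrable fun x ↦ g x * (Real.cosh (x / 2) : ℂ))
    (hfs : Integrable fun x ↦ f x * (Real.sinh (x / 2) : ℂ))
    (hgs : Integrable fun x ↦ g x * (Real.sinh (x / 2) : ℂ)) :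
    weilPoleForm (fun x ↦ f x - g x) = weilPoleForm f + weilPoleForm g -
      2 * ((2 * (∫ x, f x * (Real.cosh (x / 2) : ℂ)) *
              conj (∫ x, g x * (Real.cosh (x / 2) : ℂ))).re -
           (2 * (∫ x, f x * (Real.sinh (x / 2) : ℂ)) *
              conj (∫ x, g x * (Real.sinh (x / 2) : ℂ))).re) := by
  have key : ∀ z w : ℂ, (2 * z * conj w).re = 2 * (z * conj w).re := fun z w ↦ by
    simp only [Complex.mul_re, Complex.mul_im, Complex.re_ofNat, Complex.im_ofNat]
    ring
  unfold weilPoleForm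
  simp only [sub_mul]
  rw [integral_sub hfc hgc, integral_sub hfs hgs]
  simp only [← Complex.normSq_eq_norm_sq, Complex.normSq_sub, key]
  ring

/-- `𝓔_a(f − g) = 𝓔_a(f) + 𝓔_a(g) − 2 Re 𝓔_a(f, g)` for `f, g ∈ L²` of finite energy, with
`𝓔_a(f, g) = Σ Λ(n) n^{-1/2} D_{log n}(f, g) + ∫₀^∞ ρ(t) D_t(f, g) dt`. -/
theorem stub_localizedCut_weilDirichletEnergy_sub {f g : ℝ → ℂ} (a : ℝ) (hf : MemLp f 2)
    (hg : MemLp g 2)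
    (hfe : IntegrableOn (fun t ↦ weilArchDensity t * weilIncrement f t) (Ioi 0))
    (hge : IntegrableOn (fun t ↦ weilArchDensity t * weilIncrement g t) (Ioi 0)) :
    weilDirichletEnergy a (fun x ↦ f x - g x) =
      weilDirichletEnergy a f + weilDirichletEnergy a g -
        2 * ((∑ n ∈ weilPrimeIndex a, (Λ n : ℝ) / Real.sqrt n *
                (∫ x, (f (x + Real.log n) - f x) * conj (g (x + Real.log n) - g x)).re) +
             (∫ t in Ioi (0 : ℝ), (weilArchDensity t : ℂ) *
                ∫ x, (f (x + t) - f x) * conj (g (x + t) - g x)).re) := by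
  have hpol := stub_localizedCut_integrableOn_polar hf hg hfe hge
  have hre : IntegrableOn (fun t ↦ weilArchDensity t *
      (∫ x, (f (x + t) - f x) * conj (g (x + t) - g x)).re) (Ioi 0) := by
    have h := stub_localizedCut_integrable_re hpol
    refine h.congr (ae_of_all _ fun t ↦ ?_)
    simp only [Complex.re_ofReal_mul]
  unfold weilDirichletEnergy
  simp only [stub_localizedCut_weilIncrement_sub hf hg]
  rw [stub_localizedCut_re_setIntegral hpol]
  have harch : ∫ t in Ioi (0 : ℝ), weilArchDensity t * (weilIncrement f t + weilIncrement g t -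
      2 * (∫ x, (f (x + t) - f x) * conj (g (x + t) - g x)).re) =
      (∫ t in Ioi (0 : ℝ), weilArchDensity t * weilIncrement f t) +
        (∫ t in Ioi (0 : ℝ), weilArchDensity t * weilIncrement g t) -
        2 * ∫ t in Ioi (0 : ℝ), weilArchDensity t *
          (∫ x, (f (x + t) - f x) * conj (g (x + t) - g x)).re := by
    have e : ∀ t, weilArchDensity t * (weilIncrement f t + weilIncrement g t -
        2 * (∫ x, (f (x + t) - f x) * conj (g (x + t) - g x)).re) =
        weilArchDensity t * weilIncrement f t + weilArchDensity t * weilIncrement g t -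
          2 * (weilArchDensity t * (∫ x, (f (x + t) - f x) * conj (g (x + t) - g x)).re) := by
      intro t
      ring
    have hadd : Integrable (fun t ↦ weilArchDensity t * weilIncrement f t +
        weilArchDensity t * weilIncrement g t) (volume.restrict (Ioi 0)) := hfe.add hge
    simp_rw [e]
    rw [integral_sub hadd (hre.const_mul 2), integral_add hfe hge, integral_const_mul]
  rw [harch]
  have hsum : ∑ n ∈ weilPrimeIndex a, (Λ n : ℝ) / Real.sqrt n *
      (weilIncrement f (Real.log n) + weilIncrement g (Real.log n) -
        2 * (∫ x, (f (x + Real.log n) - f x) * conj (g (x + Real.log n) - g x)).re) =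
      (∑ n ∈ weilPrimeIndex a, (Λ n : ℝ) / Real.sqrt n * weilIncrement f (Real.log n)) +
        (∑ n ∈ weilPrimeIndex a, (Λ n : ℝ) / Real.sqrt n * weilIncrement g (Real.log n)) -
        2 * ∑ n ∈ weilPrimeIndex a, (Λ n : ℝ) / Real.sqrt n *
          (∫ x, (f (x + Real.log n) - f x) * conj (g (x + Real.log n) - g x)).re := by
    rw [Finset.mul_sum, ← Finset.sum_add_distrib, ← Finset.sum_sub_distrib]
    exact Finset.sum_congr rfl fun n _ ↦ by ring
  rw [hsum]
  ring

/-! ## Window change -/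

/-- Beyond the support width the increment is constant: if `f = 0` on `|x| ≥ b` (`b > 0`) and
`2b ≤ t` then `D_t(f) = 2‖f‖₂²` (the supports of `f` and `f(· + t)` are disjoint). -/
theorem stub_localizedCut_weilIncrement_eq_two_mul {f : ℝ → ℂ} {b t : ℝ} (hf : MemLp f 2)
    (hsupp : ∀ x, b ≤ |x| → f x = 0) (ht : 2 * b ≤ t) :
    weilIncrement f t = 2 * ∫ x, ‖f x‖ ^ 2 := by
  have hi2 : Integrable fun x ↦ ‖f x‖ ^ 2 := (memLp_two_iff_integrable_sq_norm hf.1).1 hf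
  have hpt : ∀ x, ‖f (x + t) - f x‖ ^ 2 = ‖f (x + t)‖ ^ 2 + ‖f x‖ ^ 2 := fun x ↦ by
    by_cases hx : b ≤ |x|
    · rw [hsupp x hx]
      simp
    · have hx' : b ≤ |x + t| := by
        rw [not_le] at hx
        have h1 := (abs_lt.1 hx).1
        have h2 : b ≤ x + t := by linarith
        exact h2.trans (le_abs_self _)
      rw [hsupp (x + t) hx']
      simp
  unfold weilIncrement
  simp_rw [hpt]
  rw [integral_add (hi2.comp_add_right t) hi2, integral_add_right_eq_self (fun x ↦ ‖f x‖ ^ 2) t]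
  ring

/-- **Window change.** For `f ∈ L²` vanishing on `|x| ≥ b`, `0 < b ≤ a`:
`𝓔_b(f) − M_b ‖f‖² = 𝓔_a(f) − M_a ‖f‖²` (for `2b ≤ log n < 2a` the increment `D_{log n}(f) = 2‖f‖²`
cancels against `2 Λ(n) n^{-1/2}` in `M_a − M_b`). -/
theorem stub_localizedCut_energy_window {f : ℝ → ℂ} {a b : ℝ} (hf : MemLp f 2) (hba : b ≤ a)
    (hsupp : ∀ x, b ≤ |x| → f x = 0) :
    weilDirichletEnergy b f - weilMarkovConstant b * ∫ x, ‖f x‖ ^ 2 =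
      weilDirichletEnergy a f - weilMarkovConstant a * ∫ x, ‖f x‖ ^ 2 := by
  classical
  have hsub : weilPrimeIndex b ⊆ weilPrimeIndex a :=
    fun _ hn ↦ mem_weilPrimeIndex.2 ((mem_weilPrimeIndex.1 hn).trans_le (by linarith))
  have hD : ∀ n ∈ weilPrimeIndex a \ weilPrimeIndex b,
      (Λ n : ℝ) / Real.sqrt n * weilIncrement f (Real.log n) =
        (Λ n : ℝ) / Real.sqrt n * (2 * ∫ x, ‖f x‖ ^ 2) := by
    intro n hn
    have hn' : ¬ Real.log n < 2 * b := fun h ↦ (Finset.mem_sdiff.1 hn).2 (mem_weilPrimeIndex.2 h)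
    rw [stub_localizedCut_weilIncrement_eq_two_mul hf hsupp (not_lt.1 hn')]
  unfold weilDirichletEnergy weilMarkovConstant
  rw [← Finset.sum_sdiff hsub
      (f := fun n ↦ (Λ n : ℝ) / Real.sqrt n * weilIncrement f (Real.log n)),
    ← Finset.sum_sdiff hsub (f := fun n ↦ (Λ n : ℝ) / Real.sqrt n),
    Finset.sum_congr rfl hD, ← Finset.sum_mul]
  ring

/-! ## IMS localisation -/

/-- The pointwise IMS identity: for real `p, q` and complex `U, V`,
`|pU − qV|² − Re((U − V) conj(p²U − q²V)) = (p − q)² Re(U conj V)`.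
(Cycon–Froese–Kirsch–Simon, *Schrödinger Operators*, Thm 3.2.) -/
theorem stub_localizedCut_ims_pointwise (p q : ℝ) (U V : ℂ) :
    ‖(p : ℂ) * U - (q : ℂ) * V‖ ^ 2 -
        ((U - V) * conj (((p ^ 2 : ℝ) : ℂ) * U - ((q ^ 2 : ℝ) : ℂ) * V)).re =
      (p - q) ^ 2 * (U * conj V).re := by
  simp only [← Complex.normSq_eq_norm_sq, Complex.normSq_apply, Complex.mul_re, Complex.mul_im,
    Complex.sub_re, Complex.sub_im, Complex.conj_re, Complex.conj_im, Complex.ofReal_re,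
    Complex.ofReal_im, map_sub, map_mul, Complex.conj_ofReal]
  ring

/-- **IMS for one increment.** For `u ∈ L²`, `χ` continuous with values in `[0, 1]`, `θ = 1 − χ`:
`D_t(θu) − Re D_t(u, θ²u) = ∫ (θ(x+t) − θ x)² Re(u(x+t) conj u(x)) dx
  ≤ ∫ (χ(x+t) − χ x)² ‖u(x+t)‖‖u x‖ dx`.
(Cycon–Froese–Kirsch–Simon, *Schrödinger Operators*, Thm 3.2.) -/
theorem stub_localizedCut_ims_increment :
    ∀ {u : ℝ → ℂ} {χ : ℝ → ℝ}, MemLp u 2 → Continuous χ → (∀ x, 0 ≤ χ x ∧ χ x ≤ 1) → ∀ t : ℝ,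
      weilIncrement (fun x ↦ ((1 - χ x : ℝ) : ℂ) * u x) t -
        (∫ x, (u (x + t) - u x) * (starRingEnd ℂ) ((((1 - χ (x + t)) ^ 2 : ℝ) : ℂ) * u (x + t) -
          (((1 - χ x) ^ 2 : ℝ) : ℂ) * u x)).re ≤
      ∫ x, (χ (x + t) - χ x) ^ 2 * (‖u (x + t)‖ * ‖u x‖) := by
  intro u χ hu hχc h01 t
  have hθ : MemLp (fun x ↦ ((1 - χ x : ℝ) : ℂ) * u x) 2 :=
    stub_localizedCut_memLp_mul hu (by fun_prop) fun x ↦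
      abs_le.2 ⟨by linarith [(h01 x).2], by linarith [(h01 x).1]⟩
  have hθ2 : MemLp (fun x ↦ (((1 - χ x) ^ 2 : ℝ) : ℂ) * u x) 2 :=
    stub_localizedCut_memLp_mul hu (by fun_prop) fun x ↦ by
      rw [abs_of_nonneg (sq_nonneg _)]
      obtain ⟨h0, h1⟩ := h01 x
      nlinarith
  have hut : MemLp (fun x ↦ u (x + t)) 2 :=
    hu.comp_measurePreserving (measurePreserving_add_right volume t)
  have hθ2t : MemLp (fun x ↦ (((1 - χ (x + t)) ^ 2 : ℝ) : ℂ) * u (x + t)) 2 :=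
    hθ2.comp_measurePreserving (measurePreserving_add_right volume t)
  have hi1 : Integrable fun x ↦
      ‖((1 - χ (x + t) : ℝ) : ℂ) * u (x + t) - ((1 - χ x : ℝ) : ℂ) * u x‖ ^ 2 :=
    integrable_weilIncrement_integrand hθ t
  have hi2 : Integrable fun x ↦ (u (x + t) - u x) *
      conj ((((1 - χ (x + t)) ^ 2 : ℝ) : ℂ) * u (x + t) - (((1 - χ x) ^ 2 : ℝ) : ℂ) * u x) :=
    (hut.sub hu).integrable_mul (memLp_conj (hθ2t.sub hθ2))
  have hi3 : Integrable fun x ↦ ‖u (x + t)‖ * ‖u x‖ := hut.norm.integrable_mul hu.norm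
  have hi4 : Integrable fun x ↦ (χ (x + t) - χ x) ^ 2 * (‖u (x + t)‖ * ‖u x‖) := by
    refine hi3.mono' ((Continuous.aestronglyMeasurable (by fun_prop)).mul hi3.1)
      (ae_of_all _ fun x ↦ ?_)
    rw [Real.norm_of_nonneg (by positivity)]
    have hsq : (χ (x + t) - χ x) ^ 2 ≤ 1 := by
      obtain ⟨h0, h1⟩ := h01 (x + t)
      obtain ⟨h0', h1'⟩ := h01 x
      nlinarith
    calc (χ (x + t) - χ x) ^ 2 * (‖u (x + t)‖ * ‖u x‖) ≤ 1 * (‖u (x + t)‖ * ‖u x‖) :=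
          mul_le_mul_of_nonneg_right hsq (by positivity)
      _ = ‖u (x + t)‖ * ‖u x‖ := one_mul _
  unfold weilIncrement
  rw [← stub_localizedCut_integral_re hi2, ← integral_sub hi1 (stub_localizedCut_integrable_re hi2)]
  refine integral_mono (hi1.sub (stub_localizedCut_integrable_re hi2)) hi4 fun x ↦ ?_
  simp only
  rw [stub_localizedCut_ims_pointwise]
  have h1 : (1 - χ (x + t) - (1 - χ x)) ^ 2 = (χ (x + t) - χ x) ^ 2 := by ring
  rw [h1]
  refine mul_le_mul_of_nonneg_left ?_ (sq_nonneg _)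
  calc (u (x + t) * conj (u x)).re ≤ ‖u (x + t) * conj (u x)‖ := Complex.re_le_norm _
    _ = ‖u (x + t)‖ * ‖u x‖ := by rw [norm_mul, Complex.norm_conj]

/-! ## The commutator integrand -/

/-- `∫ (χ(x+t) − χ x)² ‖u(x+t)‖ ‖u x‖ dx ≤ min(L² t², 1) ‖u‖₂²` for `χ` with values in `[0, 1]` and
`|χ x − χ y| ≤ L |x − y|` (`ab ≤ (a² + b²)/2` and translation invariance). -/
theorem stub_localizedCut_comm_le {u : ℝ → ℂ} {χ : ℝ → ℝ} {L : ℝ} (hu : MemLp u 2)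
    (h01 : ∀ x, 0 ≤ χ x ∧ χ x ≤ 1) (hχL : ∀ x y, |χ x - χ y| ≤ L * |x - y|) (t : ℝ) :
    ∫ x, (χ (x + t) - χ x) ^ 2 * (‖u (x + t)‖ * ‖u x‖) ≤
      min (L ^ 2 * t ^ 2) 1 * ∫ x, ‖u x‖ ^ 2 := by
  have hi2 : Integrable fun x ↦ ‖u x‖ ^ 2 := (memLp_two_iff_integrable_sq_norm hu.1).1 hu
  have hi : Integrable fun x ↦ min (L ^ 2 * t ^ 2) 1 * ((‖u (x + t)‖ ^ 2 + ‖u x‖ ^ 2) / 2) :=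
    (((hi2.comp_add_right t).add hi2).div_const 2).const_mul _
  calc ∫ x, (χ (x + t) - χ x) ^ 2 * (‖u (x + t)‖ * ‖u x‖)
      ≤ ∫ x, min (L ^ 2 * t ^ 2) 1 * ((‖u (x + t)‖ ^ 2 + ‖u x‖ ^ 2) / 2) := by
        refine integral_mono_of_nonneg (ae_of_all _ fun x ↦ by positivity) hi
          (ae_of_all _ fun x ↦ ?_)
        refine mul_le_mul (stub_localizedCut_sq_sub_le_min h01 hχL x t) ?_ (by positivity)
          (le_min (by positivity) zero_le_one)
        nlinarith [sq_nonneg (‖u (x + t)‖ - ‖u x‖)]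
    _ = min (L ^ 2 * t ^ 2) 1 * ∫ x, ‖u x‖ ^ 2 := by
        rw [integral_const_mul, integral_div, integral_add (hi2.comp_add_right t) hi2,
          integral_add_right_eq_self (fun x ↦ ‖u x‖ ^ 2) t]
        ring

/-- **The archimedean commutator converges**: `t ↦ ρ(t) ∫ (χ(x+t) − χ x)² ‖u(x+t)‖ ‖u x‖ dx` is
integrable on `(0, ∞)` (bounded by `ρ(t) min(L² t², 1) ‖u‖₂²`). -/
theorem stub_localizedCut_integrableOn_comm {u : ℝ → ℂ} {χ : ℝ → ℝ} {L : ℝ} (hu : MemLp u 2)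
    (hχc : Continuous χ) (h01 : ∀ x, 0 ≤ χ x ∧ χ x ≤ 1) (hL : 0 ≤ L)
    (hχL : ∀ x y, |χ x - χ y| ≤ L * |x - y|) :
    IntegrableOn (fun t ↦ weilArchDensity t *
      ∫ x, (χ (x + t) - χ x) ^ 2 * (‖u (x + t)‖ * ‖u x‖)) (Ioi 0) := by
  have _ := hL
  refine Integrable.mono'
    ((stub_localizedCut_integrableOn_rho_min (sq_nonneg L)).mul_const (∫ x, ‖u x‖ ^ 2))
    (measurable_weilArchDensity.aestronglyMeasurable.mul
      (stub_localizedCut_aesm_comm hu.1 hχc)).restrict ?_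
  refine (ae_restrict_iff' measurableSet_Ioi).2 (ae_of_all _ fun t (ht : 0 < t) ↦ ?_)
  rw [Real.norm_of_nonneg (mul_nonneg (weilArchDensity_pos ht).le
    (integral_nonneg fun x ↦ by positivity)), mul_assoc]
  exact mul_le_mul_of_nonneg_left (stub_localizedCut_comm_le hu h01 hχL t)
    (weilArchDensity_pos ht).le

end Summit.RiemannHypothesis.RiemannHypothesis.Theorems.WeilWindowFlowWindowLipschitz

end
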